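import Summits.HodgeConjecture.HodgeConjecture.Theorems.F0P3cDyRamShellLabelPlus     -- ★ (this seat): `shellLabel` (hShell discharged); brings ★ `F0P3cDyRamNormClassPlusConj` (`table_vanishing_of_shellLabel`), ★ №3 Pieces, ★ №6 `unipotentLabel`
import HarnessLib

/-!
# Crux `H413`, line LH4 «(D-RAM) FOUR-FRAME», tier-1 module `U4_Rows` §2 (iv-a)·T2 PAID: the orbital-integral table `O_u(gselStar j)` VANISHES strictly above the
# label diagonal — `table_vanishing` is the registered text of `stub_U4_table_vanishing` VERBATIM (tree `Cruxes/H413/Lines/F0_P3c_DyRamFourFrame_U4_Rows.lean`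
# ED. 1 b2ef357bfcbb4be0 :119), sorry-free

Cell `hodgecm-mathlib` (D-0151), FLOOR 0, crux item H413 = `stmt-HodgeConjecture-24833`, route of record `HCCMUnconditional`; squad F0∕P3c∕LH4, Track A; dealer LH4-plan
(g10) WORD #17∕#18 (U4 §2: T2 → LH4-p03); tier-2 hand LH4-p03 (g11).  THEOREMS ONLY (no `def`, no instance, no notation, no `sorry`, default heartbeats); lane
`--supports stmt-HodgeConjecture-24833 --as helper` — it pays the U4 module's T2 row BY NAME only when the dealer pastes `stub_U4_table_vanishing := table_vanishing`.

PROOF.  ★ `table_vanishing_of_shellLabel` (p854758) proves the conclusion for every orbital family `mU` modulo the shell-label hypothesis `hShell`; ★ `shellLabel`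
(previous file) IS that hypothesis at a ramified `σ`-stable place with a uniformiser `ϖ` — so the stub's binders `_he` and `_hϖ` are USED here, `_h2`, `_hS`, `_hmU`,
`_hRao` are carried, not used (the vanishing is a support statement: for `unipotentLabel u < j` the piece `gselStar j` vanishes identically on the class of `u` —
`f_{T±}`, `f_reg` vanish at `X = 0`; `f_reg` vanishes on `X² = 0`; `f_{T−}` vanishes on the class-`+` transvection orbit because on `K ∩` shell `NormClassPlus ⇒ LabelPlus`).

HONEST LABEL.  (D-RAM) verdict of record PRINT [LanglandsShelstad1989 Thm. p. 484 ∕ Rogawski1990 Prop. 4.9.1 (a)] ∕ XL; `HC_CM` is proved only modulo the 7 printed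
citations (2 remaining: hLiu418 = `stmt-HodgeConjecture-24832`, h413 = `stmt-HodgeConjecture-24833`) until rung 0 closes.
-/

noncomputable section

namespace Summit.HodgeConjecture.HodgeConjecture.Cruxes.H413.F0P3cDyRamTableVanishing

open MeasureTheory Measure NumberField IsDedekindDomain Topology Filter
open Literature.NumberTheory.Automorphic Literature.NumberTheory.Automorphic.UnitaryGroup Literature.NumberTheory.Automorphic.IntegralReduction
open Literature.NumberTheory.Rogawski1990 Literature.NumberTheory.GaloisRepresentations
open Literature.NumberTheory.Automorphic.HermitianLattice Literature.NumberTheory.Automorphic.UnitaryThreeFourFrame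
open Literature.MeasureTheory.Group (descConj)
open Summit.HodgeConjecture.HodgeConjecture.Cruxes.H413.F0P3cDyRamFourFramePieces
open Summit.HodgeConjecture.HodgeConjecture.Cruxes.H413.F0P3cDyRamFourFrameUnipotentLabelDefs
open Summit.HodgeConjecture.HodgeConjecture.Cruxes.H413.F0P3cDyRamNormClassPlusConj (table_vanishing_of_shellLabel)
open Summit.HodgeConjecture.HodgeConjecture.Cruxes.H413.F0P3cDyRamShellLabelPlus (shellLabel)
open scoped Matrix MatrixGroups Classical ValuativeRel WithZero

/-- **(iv-a)·T2 · SUPPORT — `stub_U4_table_vanishing` VERBATIM, PROVED**: the orbital-integral table `O_u(gselStar j)` vanishes strictly above the label diagonal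
(`unipotentLabel u < j`) for every finite set `S` of unipotent classes and every orbital family `mU` at a ramified `σ`-stable place with uniformiser `ϖ`
(★ `table_vanishing_of_shellLabel` ∘ ★ `shellLabel`). -/
theorem table_vanishing :
    ∀ (L : Type) [Field L] [NumberField L] [IsCMField L]
      {v : HeightOneSpectrum (𝓞 ↥(maximalRealSubfield L))} (w : UnitaryGroup.PlacesOver L v)
      (hw : IsCMField.complexConj L • w.1 = w.1) (_he : v.asIdeal.ramificationIdx' w.1.asIdeal ≠ 1)
      (_h2 : ¬ IsUnit (2 : 𝒪[w.1.adicCompletion L]))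
      (ϖ : (w.1.adicCompletion L)) (_hϖ : Valued.v ϖ = WithZero.exp (-1 : ℤ))
      [MeasurableSpace ((UnitaryGroup.cmDatum L 3 (Matrix.of fun i j : Fin 3 => if i.val + j.val + 1 = 3 then (1 : L) else 0)).Local v)] [BorelSpace ((UnitaryGroup.cmDatum L 3 (Matrix.of fun i j : Fin 3 => if i.val + j.val + 1 = 3 then (1 : L) else 0)).Local v)]
      [∀ γ : ((UnitaryGroup.cmDatum L 3 (Matrix.of fun i j : Fin 3 => if i.val + j.val + 1 = 3 then (1 : L) else 0)).Local v), MeasurableSpace (((UnitaryGroup.cmDatum L 3 (Matrix.of fun i j : Fin 3 => if i.val + j.val + 1 = 3 then (1 : L) else 0)).Local v) ⧸ Subgroup.centralizer ({γ} : Set ((UnitaryGroup.cmDatum L 3 (Matrix.of fun i j : Fin 3 => if i.val + j.val + 1 = 3 then (1 : L) else 0)).Local v)))]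
      [∀ γ : ((UnitaryGroup.cmDatum L 3 (Matrix.of fun i j : Fin 3 => if i.val + j.val + 1 = 3 then (1 : L) else 0)).Local v), BorelSpace (((UnitaryGroup.cmDatum L 3 (Matrix.of fun i j : Fin 3 => if i.val + j.val + 1 = 3 then (1 : L) else 0)).Local v) ⧸ Subgroup.centralizer ({γ} : Set ((UnitaryGroup.cmDatum L 3 (Matrix.of fun i j : Fin 3 => if i.val + j.val + 1 = 3 then (1 : L) else 0)).Local v)))]
      (S : Finset (ConjClasses ((UnitaryGroup.cmDatum L 3 (Matrix.of fun i j : Fin 3 => if i.val + j.val + 1 = 3 then (1 : L) else 0)).Local v)))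
      (_hS : ∀ u ∈ S, (((Quotient.out u : ((UnitaryGroup.cmDatum L 3 (Matrix.of fun i j : Fin 3 => if i.val + j.val + 1 = 3 then (1 : L) else 0)).Local v)).val : GL (Fin 3) (UnitaryGroup.LocalRing L v)).val - 1) ^ 3 = 0)
      (mU : OrbitalMeasureFamily ((UnitaryGroup.cmDatum L 3 (Matrix.of fun i j : Fin 3 => if i.val + j.val + 1 = 3 then (1 : L) else 0)).Local v)) (_hmU : mU.IsAdmissibleOn (fun γ => (ConjClasses.mk γ) ∈ S))
      (_hRao : ∀ u ∈ S, ∀ f : ((UnitaryGroup.cmDatum L 3 (Matrix.of fun i j : Fin 3 => if i.val + j.val + 1 = 3 then (1 : L) else 0)).Local v) → ℂ, IsLocSmooth f →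
        Integrable (descConj (Quotient.out u : ((UnitaryGroup.cmDatum L 3 (Matrix.of fun i j : Fin 3 => if i.val + j.val + 1 = 3 then (1 : L) else 0)).Local v))
          (Subgroup.centralizer ({(Quotient.out u : ((UnitaryGroup.cmDatum L 3 (Matrix.of fun i j : Fin 3 => if i.val + j.val + 1 = 3 then (1 : L) else 0)).Local v))} : Set ((UnitaryGroup.cmDatum L 3 (Matrix.of fun i j : Fin 3 => if i.val + j.val + 1 = 3 then (1 : L) else 0)).Local v)))
          (fun _ hg => Subgroup.mem_centralizer_singleton_iff.1 hg) f) (mU u)),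
      ∀ u : ↥S, ∀ j : Fin 4, unipotentLabel L w hw ϖ (u : ConjClasses ((UnitaryGroup.cmDatum L 3 (Matrix.of fun i j : Fin 3 => if i.val + j.val + 1 = 3 then (1 : L) else 0)).Local v)) < j →
        classOrbitalIntegral mU ((gselStar j) L v w hw ϖ) u = 0 := by
  intro L _ _ _ v w hw he _ ϖ hϖ _ _ _ _ S _ mU _ _ u j hlt
  exact table_vanishing_of_shellLabel L w hw ϖ mU (shellLabel L w hw he ϖ hϖ) u j hlt

end Summit.HodgeConjecture.HodgeConjecture.Cruxes.H413.F0P3cDyRamTableVanishing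

end
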